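import Summits.BirchSwinnertonDyer.BirchSwinnertonDyer.Theorems.RamifiedHeegnerPairGss2LowerAtThreeRankZeroJointLowerCertificate
import HarnessLib

/-!
# Route `RamifiedHeegnerPair`, crux L₁ `Gss2LowerAtThreeRankOne` (stmt-BirchSwinnertonDyer-26021) — the JOINT-LOWER calculus in McCallum
# currency, PART 2: the rank-ONE orientation. p624620 §8 FACTORS through Miller's joint currency: ONE certificate pays
# `Typed.JointLowerBoundAt W Wd 3`; U₀ of the twist then gives L₁(W) (as before) and — new reading — U₁(W) gives L₀ of the twist

HONEST FRAMING. Theorems only (no definition, no named fact, no `sorry`); ROUTE-INDEPENDENT helper file (no Theses import;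
`--supports stmt-BirchSwinnertonDyer-26021`); nothing is booked, no item is closed, BSD is not proved for any curve; every displayed
input is a hypothesis. Lead prover bsd-line-rhp-p1 g6, 2026-08-28. Sequel of p624620 (`…IrreducibleRoad.lean` §5–§8) and PART 1
(`…Gss2LowerAtThreeRankZeroJointLowerCertificate.lean`: the rank-ZERO orientation and the L₀ door).

* §1 `jointLowerBoundAt_three_of_structIrrCertificate_rankOne` — orientation (1, 0): frame and binders word for word those of p624620 §8
  EXCEPT that the twist's upper half is NOT asked, only the rationality `L(Wd,1)/Ω_{Wd} ∈ ℚ`: STRUCT ∧ ONE certificate ⟹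
  `JointLowerBoundAt W Wd 3` (the Manin-kept Gross–Zagier identity of k1-c3x Part 4 + the adjusted STEP L of p624620 §6 + the rank-`0`
  bookkeeping for the twist).
* §2 the descents: L₁(W) ⟸ §1 ∧ U₀(Wd) is p624620 §8 itself (not restated); NEW is L₀(Wd) ⟸ §1 ∧ U₁(W) — the rank-`0` twist's LOWER
  half from the rank-one curve's UPPER half (the route's U₁ 26022 at `W`).

References: [cite: MatarNekovar2019, Thm. 0.7 (p. 456) and §0.11 (p. 457)] [cite: McCallumLMS1991, §5 Lemma 5.1 (p. 303), Cor. 5.6 (p. 310)]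
[cite: JetchevSkinnerWan2017, §7.4.1 (pp. 29–31)] [cite: GrossZagier1986, Thm. I.(6.3), V.§2] [cite: Miller2011LMS, Def. 1.1]
[cite: Darmon2004, Thm. 3.6] [cite: GrossLMS1991, §4 (4.1)].
-/

-- D-0017: single-problem summit, so `Summit.BirchSwinnertonDyer.BirchSwinnertonDyer.…` repeats a namespace BY DESIGN.
set_option linter.dupNamespace false
set_option autoImplicit false

noncomputable section

open scoped Classical NumberField

open WeierstrassCurve NumberField IsDedekindDomain
  Literature.NumberTheory.EllipticCurves Literature.NumberTheory.EllipticCurves.ModularForms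
  Literature.NumberTheory.EllipticCurves.Rank1Residual
  Literature.NumberTheory.EllipticCurves.Rank1Residual.Typed
  Literature.NumberTheory.EllipticCurves.KrizLi2019
  Literature.NumberTheory.QuadraticFields
  Summit.BirchSwinnertonDyer.Rank1Residual
  Summit.BirchSwinnertonDyer.Rank1Residual.Additive
  Summit.BirchSwinnertonDyer.Rank1Residual.X11b
  Summit.BirchSwinnertonDyer.Rank1Residual.GaloisImage
  Summit.BirchSwinnertonDyer.BirchSwinnertonDyer.Theorems
  Summit.BirchSwinnertonDyer.BirchSwinnertonDyer.Theorems.AdditiveBranchIMCGordTwoRankOne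

namespace Summit.BirchSwinnertonDyer.BirchSwinnertonDyer.Theorems.RamifiedPairLowerBound

/-! ## §1 Orientation (1, 0): the JOINT lower half from ONE certificate, `W` of analytic rank one -/

/-- **JOINT lower half of the pair `(W, W^{(d_K)})` from ONE certificate — orientation (1, 0).** Frame and binders word for word those of
p624620 §8 (`missingLowerBoundAt_three_rankOne_gss_of_structIrrCertificate_of_upperTwist`) EXCEPT that the twist's upper half
`MissingUpperBoundAt Wd 3` is NOT asked: only the rationality `L(Wd,1)/Ω_{Wd} = qd ∈ ℚ` of the rank-`0` twist's central value is
(`hqd`). Conclusion: `Typed.JointLowerBoundAt W Wd 3`. Chain: `E[3]` irreducible on the Gss2 leaf; the conductor-`1` datum (Darmon 3.6,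
Shimura reciprocity); `P` non-torsion (Gross–Zagier), rank one + `Ш(E/K)` finite (Kolyvagin); `E(K)[3] = 0`; `3^{M₀} ∥ P`; the adjusted
STEP L from the certificate and the Matar–Nekovář fact (p624620 §6); the Manin-kept Gross–Zagier identity (k1-c3x Part 4) with its
odd-`p` descent `ord₃#Ш(E/K) = ord₃#Ш(W) + ord₃#Ш(Wd)`; the rank-`0` bookkeeping `#Ш_an(Wd) = qd·t_d²/∏c(Wd)`.
[cite: MatarNekovar2019, Thm. 0.7 (p. 456) and §0.11 (p. 457)] [cite: McCallumLMS1991, §5 Lemma 5.1 (p. 303) and Cor. 5.6 (p. 310)]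
[cite: JetchevSkinnerWan2017, §7.4.1 (pp. 29–31)] [cite: GrossZagier1986, Thm. I.(6.3) and V.§2] [cite: Miller2011LMS, Def. 1.1] -/
theorem jointLowerBoundAt_three_of_structIrrCertificate_rankOne
    (W : WeierstrassCurve ℚ) [W.IsElliptic] [W.IsGloballyMinimal] [NeZero (W.conductorNorm ℤ)]
    (K : Type) [Field K] [NumberField K]
    (Dt : ModularParametrizationData W (W.conductorNorm ℤ))
    (H : HeegnerDatum (W.conductorNorm ℤ) (NumberField.discr K)) (ι : K →+* ℂ)
    (P : (W.baseChange K).toAffine.Point)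
    (hGZ : gross_zagier (W.conductorNorm ℤ) W K) (hKo : kolyvagin (W.conductorNorm ℤ) W K)
    (hGZK : rank_eq_analyticRank_of_analyticRank_le_one) (hmod : hasEntireLFunction_rat)
    (hrec : heegnerPointOfConductor_one_galoisConj (W.conductorNorm ℤ) W K)
    (h36 : phi_heegnerTau_mem_range_map_singularModuliField (W.conductorNorm ℤ) W K)
    (hMN : MatarNekovar2019.thm07_pow_dvd_card_sha_primary_of_certificate_of_irreducible)
    (hCM : ¬ W.HasCM) (hadd : Addv W 3) (hsub : SubGss W 3) (hr : W.analyticRank = 1)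
    (hK : IsImaginaryQuadratic K) (hHN : SatisfiesHeegnerHypothesis (W.conductorNorm ℤ) K)
    (hP : WeierstrassCurve.Affine.Point.map ι.toRatAlgHom P = heegnerPointComplex Dt H)
    (hLt : (W.quadraticTwist (NumberField.discr K : ℚ)).entireLFunction 1 ≠ 0)
    (Wd : WeierstrassCurve ℚ) [Wd.IsElliptic] [Wd.IsGloballyMinimal] (Cd : VariableChange ℚ)
    (hWd : Cd • W.quadraticTwist (NumberField.discr K : ℚ) = Wd)
    {qd : ℚ} (hqd : Wd.entireLFunction 1 / (Wd.realPeriodRat : ℂ) = (qd : ℂ))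
    {M : ℕ} (hcert : Three.Koly.CertificateAt Dt H.β ι 3 M)
    (hM : (2 * M : ℤ) ≤ padicValNat 3 W.tamagawaProduct + padicValNat 3 Wd.tamagawaProduct +
      2 * padicValRat 3 (Dt.c : ℚ)) :
    JointLowerBoundAt W Wd 3 := by
  -- adapted from p624620 §8/§7: the twist's upper half is NOT subtracted; the pair statement is kept
  have hp2 : (3 : ℕ) ≠ 2 := by decide
  have hD0 : (NumberField.discr K : ℚ) ≠ 0 := by exact_mod_cast NumberField.discr_ne_zero K
  haveI hEt : (W.quadraticTwist (NumberField.discr K : ℚ)).IsElliptic := W.isElliptic_quadraticTwist hD0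
  -- `3 ∣ N_W` splits in `K`: `3 ∤ d_K`, `3 ∤ #𝓞_K^×`, `d_K ≠ -3`; and `d_K ≠ -4` since `β² ≡ d_K (mod 3)`
  have h3N : 3 ∣ W.conductorNorm ℤ :=
    (W.dvd_conductorNorm_iff_not_hasGoodReductionAtPrime 3).mpr (not_good_of_addv W 3 hadd)
  obtain ⟨hd3, hμ⟩ := X11b.Three.not_dvd_discr_and_not_dvd_torsionOrder_of_heegner hK hHN hp2 h3N
  have h3 : NumberField.discr K ≠ -3 := fun h ↦ hd3 (h ▸ ⟨-1, by norm_num⟩)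
  have h4 : NumberField.discr K ≠ -4 := by
    intro hK4
    have h12 : (3 : ℤ) ∣ 4 * (W.conductorNorm ℤ : ℤ) := Dvd.dvd.mul_left (by exact_mod_cast h3N) 4
    have h3d : (3 : ℤ) ∣ H.β ^ 2 - NumberField.discr K := dvd_trans h12 H.dvd_sq_sub
    have hcast : ((H.β ^ 2 - NumberField.discr K : ℤ) : ZMod 3) = 0 :=
      (ZMod.intCast_zmod_eq_zero_iff_dvd _ 3).mpr h3d
    have hdK : ((NumberField.discr K : ℤ) : ZMod 3) = -4 := by rw [hK4]; push_cast; ring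
    push_cast at hcast
    rw [hdK] at hcast
    have key : ∀ b : ZMod 3, b ^ 2 - (-4 : ZMod 3) ≠ 0 := by decide
    exact key _ hcast
  haveI h3p : Fact (Nat.Prime 3) := ⟨Nat.prime_three⟩
  -- `E[3]` irreducible on the Gss2 leaf
  have hirr : Irr W 3 := irr_of_subGss_of_ne_two W 3 hp2 hadd hsub
  -- the conductor-`1` Kolyvagin–Heegner datum with `P_1 = y_K = P`
  obtain ⟨d₁⟩ := nonempty_kolyvaginHeegnerData_one_of_darmon36 h36 hK Dt H.β ι H.dvd_sq_sub
  have hPd : d₁.toGeomPoints d₁.derivedPoint = toGeomPoints (W.baseChange K) P :=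
    KolyvaginBottom.toGeomPoints_derivedPoint_one_eq hrec hK hHN hP d₁ rfl
  -- `P` non-torsion, rank one and `Ш(E/K)` finite
  have hPinf : ¬ IsOfFinAddOrder P :=
    not_isOfFinAddOrder_of_heegner_of_analyticRank_eq_one W (W.conductorNorm ℤ) K Dt H ι P hGZ hmod hr hK hHN hLt hP
  obtain ⟨hrank, hSha⟩ := hKo hK hHN ⟨Dt, H, ι, hP⟩ hPinf
  haveI : Finite (W.baseChange K).sha := hSha
  -- `E(K)[3] = 0`
  have hbot := torsionBy_eq_bot_of_isImaginaryQuadratic_of_hasIrreducibleModPGaloisRep W K hK Nat.prime_three hirr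
  have hiv : ∀ x : (W.baseChange K).toAffine.Point, (3 : ℕ) • x = 0 → x = 0 := fun x hx ↦ by
    have hmem : x ∈ AddSubgroup.torsionBy (W.baseChange K).toAffine.Point (((3 : ℕ) : ℕ) : ℤ) := by
      rw [mem_torsionBy_iff, natCast_zsmul]
      exact hx
    rw [hbot] at hmem
    exact hmem
  -- `3^{M₀} ∥ P`
  haveI : Module.Finite ℤ (W.baseChange K).toAffine.Point := (W.baseChange K).module_finite_point_holds
  obtain ⟨M₀, x₀, hx₀, hmax⟩ := exists_pow_smul_eq_and_forall_ne hPinf (p := 3) Nat.prime_three.two_le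
  have hdiv : ∃ Q : (W.baseChange K).toAffine.Point, ((3 ^ M₀ : ℕ) : ℤ) • Q = P :=
    ⟨x₀, by rw [natCast_zsmul]; exact hx₀⟩
  have hndiv : ¬ ∃ Q : (W.baseChange K).toAffine.Point, ((3 ^ (M₀ + 1) : ℕ) : ℤ) • Q = P := by
    rintro ⟨Q, hQ⟩
    exact hmax Q (by rw [← natCast_zsmul]; exact hQ)
  -- the certificate ⟹ the ADJUSTED STEP L at the datum (p624620 §6)
  obtain ⟨n, r, d, hn, hnd⟩ := hcert
  have hL' : (2 * padicValNat 3 (AddSubgroup.zmultiples P).index : ℤ) ≤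
      padicValNat 3 (W.baseChange K).shaOrder + padicValNat 3 W.tamagawaProduct +
        padicValNat 3 Wd.tamagawaProduct + 2 * padicValRat 3 (Dt.c : ℚ) :=
    adjustedIndexBound_of_certificate_of_structIrr hMN W hCM K hK h3 h4 hHN 3 hp2 hirr Dt H.β ι d₁ P
      hPd hPinf hrank hiv hdiv hndiv d hn.1 hn.2.2 hnd Wd hM
  -- the Manin-kept Gross–Zagier identity (k1-c3x Part 4) and the odd-`p` descent of `Ш`
  have hu : padicValRat 3 (Cd.u : ℚ) = 0 :=
    HeegnerKolyvagin.padicValRat_u_eq_zero_of_twist_minimal' W 3 K hK hHN hadd.1 Cd hWd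
  obtain ⟨-, -, hsha, q, hq, hval⟩ := HeegnerKolyvagin.exists_shaAn_padicVal_eq_of_heegner_maninKept W 3
    (W.conductorNorm ℤ) K Dt H ι P hGZ hKo hGZK hmod hK hHN hP hp2 hμ hr hLt Wd Cd hWd hu qd hqd
  -- the rank-`0` twist: `#Ш_an(Wd) = qd·t_d²/∏c(Wd)`
  have hLt' : (W.quadraticTwist (NumberField.discr K : ℚ)).entireLFunction = Wd.entireLFunction := by
    rw [← hWd, entireLFunction_smul]
  have hLd1 : Wd.entireLFunction 1 ≠ 0 := by rw [← hLt']; exact hLt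
  have hrd : Wd.analyticRank = 0 := (Wd.analyticRank_eq_zero_iff_holds (hmod Wd)).2 hLd1
  have hshad := shaAn_eq_of_lOne_div_eq_of_rankZero hGZK Wd hrd hqd
  have hΩd : (Wd.realPeriodRat : ℂ) ≠ 0 := by exact_mod_cast Wd.realPeriodRat_pos_holds.ne'
  have hqd0 : qd ≠ 0 := by
    intro h0
    apply hLd1
    rw [← div_mul_cancel₀ (Wd.entireLFunction 1) hΩd, hqd, h0]
    simp
  have v2 := padicValRat_mul_sq_div 3 hqd0 Wd.torsionOrder_pos_holds Wd.tamagawaProduct_pos_holds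
  refine ⟨q, qd * (Wd.torsionOrder : ℚ) ^ 2 / (Wd.tamagawaProduct : ℚ), hq, hshad, ?_⟩
  rw [v2]
  have e2 : (padicValNat 3 (W.baseChange K).shaOrder : ℤ) =
      padicValNat 3 W.shaOrder + padicValNat 3 Wd.shaOrder := by exact_mod_cast hsha
  linarith

/-! ## §2 The new descent of §1: L₀ at the twist from U₁ at the base -/

-- NOTE. L₁(W) ⟸ §1 ∧ U₀(Wd) is LITERALLY p624620 §8 (`missingLowerBoundAt_three_rankOne_gss_of_structIrrCertificate_of_upperTwist`):
-- `U₀(Wd)` supplies the rationality of `L(Wd,1)/Ω_{Wd}` (p624620 §5) and is then subtracted by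
-- `Typed.missingLowerBoundAt_of_joint_of_upper`; it is not restated here (dedup), only the NEW descent is.

/-- **NEW READING: L₀ AT THE TWIST ⟸ §1 ∧ U₁(W).** At the same frame, the rank-`0` twist's LOWER half `MissingLowerBoundAt Wd 3` follows from
the joint lower half and the rank-ONE curve's UPPER half `MissingUpperBoundAt W 3` (the route's member U₁ 26022 at `W`), given the
rationality of `L(Wd,1)/Ω_{Wd}`. Descent `Typed.missingLowerBoundAt_partner_of_joint_of_upper`. [cite: Miller2011LMS, Def. 1.1]
[cite: MatarNekovar2019, Thm. 0.7 (p. 456) and §0.11 (p. 457)] -/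
theorem missingLowerBoundAt_twist_three_of_jointLowerRoad_of_upperRankOne
    (W : WeierstrassCurve ℚ) [W.IsElliptic] [W.IsGloballyMinimal] [NeZero (W.conductorNorm ℤ)]
    (K : Type) [Field K] [NumberField K]
    (Dt : ModularParametrizationData W (W.conductorNorm ℤ))
    (H : HeegnerDatum (W.conductorNorm ℤ) (NumberField.discr K)) (ι : K →+* ℂ)
    (P : (W.baseChange K).toAffine.Point)
    (hGZ : gross_zagier (W.conductorNorm ℤ) W K) (hKo : kolyvagin (W.conductorNorm ℤ) W K)
    (hGZK : rank_eq_analyticRank_of_analyticRank_le_one) (hmod : hasEntireLFunction_rat)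
    (hrec : heegnerPointOfConductor_one_galoisConj (W.conductorNorm ℤ) W K)
    (h36 : phi_heegnerTau_mem_range_map_singularModuliField (W.conductorNorm ℤ) W K)
    (hMN : MatarNekovar2019.thm07_pow_dvd_card_sha_primary_of_certificate_of_irreducible)
    (hCM : ¬ W.HasCM) (hadd : Addv W 3) (hsub : SubGss W 3) (hr : W.analyticRank = 1)
    (hK : IsImaginaryQuadratic K) (hHN : SatisfiesHeegnerHypothesis (W.conductorNorm ℤ) K)
    (hP : WeierstrassCurve.Affine.Point.map ι.toRatAlgHom P = heegnerPointComplex Dt H)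
    (hLt : (W.quadraticTwist (NumberField.discr K : ℚ)).entireLFunction 1 ≠ 0)
    (Wd : WeierstrassCurve ℚ) [Wd.IsElliptic] [Wd.IsGloballyMinimal] (Cd : VariableChange ℚ)
    (hWd : Cd • W.quadraticTwist (NumberField.discr K : ℚ) = Wd)
    {qd : ℚ} (hqd : Wd.entireLFunction 1 / (Wd.realPeriodRat : ℂ) = (qd : ℂ))
    (hUW : MissingUpperBoundAt W 3)
    {M : ℕ} (hcert : Three.Koly.CertificateAt Dt H.β ι 3 M)
    (hM : (2 * M : ℤ) ≤ padicValNat 3 W.tamagawaProduct + padicValNat 3 Wd.tamagawaProduct +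
      2 * padicValRat 3 (Dt.c : ℚ)) :
    MissingLowerBoundAt Wd 3 :=
  missingLowerBoundAt_partner_of_joint_of_upper
    (jointLowerBoundAt_three_of_structIrrCertificate_rankOne W K Dt H ι P hGZ hKo hGZK hmod hrec h36 hMN hCM hadd hsub hr hK
      hHN hP hLt Wd Cd hWd hqd hcert hM) hUW

end Summit.BirchSwinnertonDyer.BirchSwinnertonDyer.Theorems.RamifiedPairLowerBound

end
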